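import Summits.AtomisticToContinuum.Crystallization.Theorems.ChartedPlanarOrderTubeConvexSplit

/-!
# 7c′ᴸ `TubeLipschitzW'` ⟸ span moduli: the adapter over the landed straddle rearrangement (decomp-a2c lens-3 g24)

The ANALYTIC half 7c′ᴸ `TubeLipschitzW' Λ ρ` of slot 7c′ (`…TubeConvexSplit`) asks for cross-gap weights `κ ≥ 0`, summable WITH first
moment, dominating the gap-stress differences of tube profiles.  The bookkeeping that turns SPAN-INDEXED pair moduli `τ s` (the force of a
layer pair of span `s = l − k` is `τ s`-Lipschitz in its offset along tube profiles: `…TubeMonotoneSplit.IsPairModulus`) into such weights is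
ALREADY IN THE TREE (lens-3 g23, `…ChartedPlanarOrderTubeMonotoneSplit`: `cnt s j = (s − |j|)⁺`, `kap τ j = Σ'_s cnt s j · τ s`, `summable_kap`,
`summable_abs_mul_kap` from `Σ s³ τ s < ∞`, the finite rearrangement `sum_norm_sub_le`, tube summability `summable_famOf`), and so is the
straddle summability at the centre (`…StraddleSummable.summable_pairFamily_straddle`, D1s — no cleanliness needed).  This file only PACKAGES
them for the convex split — nothing is re-proved:

* `summable_famOf_incr`, `summable_famOf_tube` — (S1): the straddling pair family `famOf a b m h` is summable on the configuration's own
  increments (independent periods, stacked, `δ`-separated) and then on every `ρ`-tube profile, given span moduli;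
* ★ `isTubeLipschitz_of_pairModulus`, `tubeLipschitzData_of_pairModulus` — `IsPairModulus a b w ρ τ`, `τ ≥ 0`, `Σ s³ τ s < ∞` ⇒
  `TubeLipschitzData a b w ρ` with `κ = kap τ` (the `ℓ¹` half of g23's `tubeMonotone_of_near_far`, extracted verbatim);
* statements `PairModulusW' Λ ρ` / `PairModulusW Λ ρ` — g23's `FarPairStiffnessL1 Λ ρ K` WITHOUT the (retired, infeasible) far-mass budget and on
  the W′ / W binder lists: «span moduli with finite third moment exist on the `ρ`-tube» [ANALYTIC · TRUE-type · brick-level: `τ s ≤ C (s(h₀ − ρ))⁻⁶`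
  from (o) PairForceLipschitz + (q) PlanarLatticeSums; census W161B: `κ_0…5 = 31.15, 0.567, 0.069, 0.016, 0.005, 0.002`, `Σ|j|κ_j = 1.60`];
* ★ glue `tubeLipschitzW'_of_pairModulusW'`, `tubeLipschitzW_of_pairModulusW`, and the slot-level composition
  `tubeConvexW'_of_pairModulus_convexity : PairModulusW' Λ ρ → TubeConvexityW' Λ ρ → TubeConvexW' Λ ρ`.

After this file 7c′ᴸ ⟸ 7c′ᴾ `PairModulusW'` (pure LJ lattice-sum estimate, no profile bookkeeping left).  Def-bearing (two Props); no
instances, no notation; sorry-free.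
-/

noncomputable section

namespace Summit.AtomisticToContinuum.Crystallization.Theorems.ChartedPlanarOrderStraddleLipschitz

open Summit.AtomisticToContinuum.Crystallization.Theorems.OverbindingBudgetElasticSplitShear (StressFree)
open Summit.AtomisticToContinuum.Crystallization.Theorems.ChartedPlanarOrderChunkFloor (E3)
open Summit.AtomisticToContinuum.Crystallization.Theorems.ChartedPlanarOrderRigidityDoor (IsNash)
open Summit.AtomisticToContinuum.Crystallization.Theorems.ChartedPlanarOrderDensityDichotomy (μS IsSep)
open Summit.AtomisticToContinuum.Crystallization.Theorems.ChartedPlanarOrderDoorLayered (Layered)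
open Summit.AtomisticToContinuum.Crystallization.Theorems.ChartedPlanarOrderProfileSlavingLJ (Straddle IsStacked gapStress incr tube)
open Summit.AtomisticToContinuum.Crystallization.Theorems.ChartedPlanarOrderStraddleSummable (summable_pairFamily_straddle)
open Summit.AtomisticToContinuum.Crystallization.Theorems.ChartedPlanarOrderTubeMonotoneSplit
  (IsPairModulus kap kap_nonneg summable_kap summable_abs_mul_kap famOf gapStress_eq_tsum famOf_incr sum_norm_sub_le
    summable_norm_famOf_sub summable_famOf)
open Summit.AtomisticToContinuum.Crystallization.Theorems.ChartedPlanarOrderCleanScaleP (cleanStackedIndependentW)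
open Summit.AtomisticToContinuum.Crystallization.Theorems.OverbindingBudgetScaleWidening (IsCleanW)
open Summit.AtomisticToContinuum.Crystallization.Theorems.ChartedPlanarOrderTubeConvex (IsTubeLipschitz TubeConvexW' TubeConvexW)
open Summit.AtomisticToContinuum.Crystallization.Theorems.ChartedPlanarOrderTubeConvexSplit
  (TubeLipschitzData TubeLipschitzW' TubeConvexityW' TubeLipschitzW TubeConvexityW tubeConvexW'_of_split tubeConvexW_of_split)

/-! ## 1. (S1): straddle summability at the centre and on the tube -/

section Config

variable {δ ρ : ℝ} {a b : E3} {w : ℤ → E3} {τ : ℕ → ℝ}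

/-- (S1) at the centre — the straddling pair family on the configuration's own increments is summable (D1s technology: independent periods,
stacked, `δ`-separated; NO cleanliness). [cites `summable_pairFamily_straddle`, `famOf_incr`] -/
theorem summable_famOf_incr (hδ : 0 < δ) (hab : LinearIndependent ℝ ![a, b]) (hst : IsStacked a b w) (hS : IsSep δ (Layered a b w))
    (m : ℤ) : Summable (famOf a b m (incr w)) := by
  rw [famOf_incr]
  exact summable_pairFamily_straddle hδ hab hst hS m

/-- (S1) on the tube — given span moduli, the straddling pair family is summable on every `ρ`-tube profile. [cites `summable_famOf`] -/
theorem summable_famOf_tube (hδ : 0 < δ) (hab : LinearIndependent ℝ ![a, b]) (hst : IsStacked a b w) (hS : IsSep δ (Layered a b w))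
    (hτ0 : ∀ s, 0 ≤ τ s) (hτ3 : Summable (fun s : ℕ => (s : ℝ) ^ 3 * τ s)) (hP : IsPairModulus a b w ρ τ) (m : ℤ)
    {h : ℤ → E3} (hh : ∀ i, h i ∈ tube w ρ i) : Summable (famOf a b m h) :=
  summable_famOf hτ0 hτ3 (summable_famOf_incr hδ hab hst hS m) hP hh

/-! ## 2. ★ `TubeLipschitzData` from span moduli -/

/-- ★ **`IsTubeLipschitz` from span moduli** (the `ℓ¹` half of g23's `tubeMonotone_of_near_far`, extracted): `κ = kap τ`. -/
theorem isTubeLipschitz_of_pairModulus (hδ : 0 < δ) (hab : LinearIndependent ℝ ![a, b]) (hst : IsStacked a b w)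
    (hS : IsSep δ (Layered a b w)) (hτ0 : ∀ s, 0 ≤ τ s) (hτ3 : Summable (fun s : ℕ => (s : ℝ) ^ 3 * τ s))
    (hP : IsPairModulus a b w ρ τ) : IsTubeLipschitz a b w ρ (kap τ) := by
  intro m h h' hh hh'
  have hSm := summable_famOf_incr hδ hab hst hS m
  have hN1 := summable_norm_famOf_sub hτ0 hτ3 hP hh hh' (m := m)
  have hFh := summable_famOf hτ0 hτ3 hSm hP hh
  have hFh' := summable_famOf hτ0 hτ3 hSm hP hh'
  rw [gapStress_eq_tsum, gapStress_eq_tsum, ← hFh.tsum_sub hFh']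
  calc ‖∑' p, (famOf a b m h p - famOf a b m h' p)‖ ≤ ∑' p, ‖famOf a b m h p - famOf a b m h' p‖ := norm_tsum_le_tsum_norm hN1
    _ ≤ ∑' i : ℤ, kap τ (i - m) * ‖h i - h' i‖ := hN1.tsum_le_of_sum_le (sum_norm_sub_le hτ0 hτ3 hP hh hh')
    _ = ∑' j : ℤ, kap τ j * ‖h (m + j) - h' (m + j)‖ := by
        rw [← (Equiv.addLeft m).tsum_eq]
        exact tsum_congr fun j => by simp only [Equiv.coe_addLeft, add_sub_cancel_left]

/-- ★ **7c′ᴸ-data from span moduli**: `TubeLipschitzData a b w ρ` with the weights `kap τ` (nonnegative, summable, finite first moment —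
all three from `…TubeMonotoneSplit`). -/
theorem tubeLipschitzData_of_pairModulus (hδ : 0 < δ) (hab : LinearIndependent ℝ ![a, b]) (hst : IsStacked a b w)
    (hS : IsSep δ (Layered a b w)) (hτ0 : ∀ s, 0 ≤ τ s) (hτ3 : Summable (fun s : ℕ => (s : ℝ) ^ 3 * τ s))
    (hP : IsPairModulus a b w ρ τ) : TubeLipschitzData a b w ρ :=
  ⟨kap τ, kap_nonneg hτ0, summable_kap hτ0 hτ3, summable_abs_mul_kap hτ0 hτ3, isTubeLipschitz_of_pairModulus hδ hab hst hS hτ0 hτ3 hP⟩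

end Config

/-! ## 3. The brick-level statements and the slot-level glue -/

/-- **7c′ᴾ · `PairModulusW' Λ ρ`** — span moduli on the `ρ`-tube, W′ binder list (= `TubeLipschitzW'`'s, verbatim): around every admissible
zero-gap-stress stacked configuration the layer-pair forces admit span-indexed tube moduli `τ ≥ 0` with `Σ s³ τ s < ∞` (g23's `FarPairStiffnessL1`
without the far-mass budget).  Why it might fail: only through the junk regime `ρ ≥` half the minimal layer height (tube profiles letting layers
touch); at `ρ = 1/40 ≪ h₀ ≈ 0.8` it is a routine LJ lattice-sum estimate `τ s ≤ C (s(h₀ − ρ))⁻⁶`. [ANALYTIC · TRUE-type · ATTACKABLE from bricks (o)(q)] -/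
def PairModulusW' (Λ ρ : ℝ) : Prop :=
  ∀ δ : ℝ, 0 < δ → ∀ (a b : E3) (w : ℤ → E3), ‖a‖ ≤ Λ → ‖b‖ ≤ Λ →
    IsSep δ (Layered a b w) → IsCleanW (μS (Layered a b w)) → IsNash (μS (Layered a b w)) → IsStacked a b w →
    StressFree (Layered a b w) → (∀ m : ℤ, gapStress a b m (incr w) = 0) →
    ∃ τ : ℕ → ℝ, (∀ s, 0 ≤ τ s) ∧ Summable (fun s : ℕ => (s : ℝ) ^ 3 * τ s) ∧ IsPairModulus a b w ρ τ

/-- **`PairModulusW Λ ρ`** — the same on `TubeLipschitzW`'s (IsNash-only) binder list; STRONGER than `PairModulusW'`. [ANALYTIC] -/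
def PairModulusW (Λ ρ : ℝ) : Prop :=
  ∀ δ : ℝ, 0 < δ → ∀ (a b : E3) (w : ℤ → E3), ‖a‖ ≤ Λ → ‖b‖ ≤ Λ →
    IsSep δ (Layered a b w) → IsCleanW (μS (Layered a b w)) → IsNash (μS (Layered a b w)) → IsStacked a b w →
    ∃ τ : ℕ → ℝ, (∀ s, 0 ≤ τ s) ∧ Summable (fun s : ℕ => (s : ℝ) ^ 3 * τ s) ∧ IsPairModulus a b w ρ τ

/-- `PairModulusW` (IsNash-only binders) implies `PairModulusW'`. (docstring added at landing — gate lint; statement and proof byte-identical) -/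
theorem pairModulusW'_of_W {Λ ρ : ℝ} (h : PairModulusW Λ ρ) : PairModulusW' Λ ρ :=
  fun δ hδ a b w ha hb hs hc hn hst _ _ => h δ hδ a b w ha hb hs hc hn hst

/-- ★ **7c′ᴸ ⟸ 7c′ᴾ** (independence of the periods from `cleanStackedIndependentW`). -/
theorem tubeLipschitzW'_of_pairModulusW' {Λ ρ : ℝ} (h : PairModulusW' Λ ρ) : TubeLipschitzW' Λ ρ := by
  intro δ hδ a b w ha hb hs hc hn hst hf hz
  obtain ⟨τ, hτ0, hτ3, hP⟩ := h δ hδ a b w ha hb hs hc hn hst hf hz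
  exact tubeLipschitzData_of_pairModulus hδ (cleanStackedIndependentW δ hδ a b w hs hc hst) hst hs hτ0 hτ3 hP

/-- the IsNash-only twin: `TubeLipschitzW ⟸ PairModulusW`. -/
theorem tubeLipschitzW_of_pairModulusW {Λ ρ : ℝ} (h : PairModulusW Λ ρ) : TubeLipschitzW Λ ρ := by
  intro δ hδ a b w ha hb hs hc hn hst
  obtain ⟨τ, hτ0, hτ3, hP⟩ := h δ hδ a b w ha hb hs hc hn hst
  exact tubeLipschitzData_of_pairModulus hδ (cleanStackedIndependentW δ hδ a b w hs hc hst) hst hs hτ0 hτ3 hP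

/-- ★ **slot 7c′ of record ⟸ 7c′ᴾ ∧ 7c′ᶜ**: `PairModulusW' Λ ρ → TubeConvexityW' Λ ρ → TubeConvexW' Λ ρ`. -/
theorem tubeConvexW'_of_pairModulus_convexity {Λ ρ : ℝ} (hP : PairModulusW' Λ ρ) (hC : TubeConvexityW' Λ ρ) : TubeConvexW' Λ ρ :=
  tubeConvexW'_of_split (tubeLipschitzW'_of_pairModulusW' hP) hC

/-- the IsNash-only twin at slot level: `PairModulusW Λ ρ → TubeConvexityW Λ ρ → TubeConvexW Λ ρ`. -/
theorem tubeConvexW_of_pairModulus_convexity {Λ ρ : ℝ} (hP : PairModulusW Λ ρ) (hC : TubeConvexityW Λ ρ) : TubeConvexW Λ ρ :=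
  tubeConvexW_of_split (tubeLipschitzW_of_pairModulusW hP) hC

end Summit.AtomisticToContinuum.Crystallization.Theorems.ChartedPlanarOrderStraddleLipschitz

end
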